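import Summits.NavierStokesRegularity.NavierStokesRegularity.Theorems.HeredityAtOne.Negative.NestedHillStreamProfile
import Literature.Analysis.FluidPDE.AxisymHouLiVariables

/-!
# The nested-Hill velocity field (the S⁺ witness against `SliceHeredityAtOne`, III: the field on `ℝ³`)

Cell `ns-blowup`, seat `ns-blowup-refuter4` (g5), NEGATIVE lane of item 19249 `HeredityAtOne`
(`--supports`; nothing here asserts a route statement). Third file of the nested-Hill line
(`NestedHillProfile.lean`: data `P : HillData`, plateau cutoff `φ`, vorticity-moment profile `H`;
`NestedHillStreamProfile.lean`: stream profile `G`, `G′ = −H/2`). THIS file puts the two profiles on `ℝ³`: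

* the axial profile `α(q) = 2 G(q) − q H(q)` and the velocity field
  `v(x) = α(|x|²) e₂ + (H(|x|²) x₂) x` (`field`) — the smoothed Hill spherical vortex: in the core
  `|x|² ≤ q₁` it is Hill's interior flow `(2g₀ − (2A/5)|x|²) e₂ + (A/5) x₂ x`, outside `|x|² ≥ q₂` the exact
  point dipole `H(|x|²)(x₂ x − (|x|²/3) e₂)`;
* the vorticity quotient profile `η(x) = A φ(|x|²)` (`eta`), with `0 ≤ η ≤ A`, `η = A` on the core, `η = 0`
  off `|x|² ≥ q₂`;
* the derivative `fieldDeriv` with `HasFDerivAt field (fieldDeriv x) x` and the coordinate formula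
  `fderiv_field_single`, smoothness of `field` and `eta`;
* the two identities that make it a signed swirl-free slice: `curl v = η • rotGen` (`curl_field`, from
  `H − 2α′ = Aφ`) and `div v = 0` (`isDivFree_field`, from `2α′ + 2qH′ + 4H = 0`).

LABEL: kernel calculus of an explicit field; no named fact; nothing about Navier–Stokes dynamics. WHAT THIS IS
NOT: not evidence on item 19249 — a building block of the refutation of the design-free STRENGTHENING S⁺ only
(assembly via `SliceHeredityCap.not_sliceHeredityAtOne_of_capped_signed_envelope_slice`, 19249-disprove-1).
[folklore] (Hill 1894; Acheson, *Elementary Fluid Dynamics* §5.5, cf.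
`Literature/Analysis/FluidPDE/HillSphericalVortex.lean`.)
-/

noncomputable section

namespace Summit.NavierStokesRegularity.HeredityAtOneNestedHill

open Set MeasureTheory intervalIntegral Filter Topology

namespace HillData

variable (P : HillData)

/-! ## §F2a The nested Hill velocity field and its derivative -/

section Field

open Literature.Analysis.FluidPDE InnerProductSpace

/-- the axial profile `α = 2G − qH` (coefficient of `e₂`). [folklore] -/
def alpha (q : ℝ) : ℝ := 2 * P.G q - q * P.H q

/-- `α` is smooth. [folklore] -/
theorem alpha_contDiff {n : ℕ∞} : ContDiff ℝ n P.alpha :=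
  (contDiff_const.mul P.G_contDiff).sub (contDiff_id.mul P.H_contDiff)

/-- `α′ = −2H − qH′`. [folklore] -/
theorem hasDerivAt_alpha (q : ℝ) : HasDerivAt P.alpha (-(2 * P.H q) - q * deriv P.H q) q := by
  have h : HasDerivAt P.alpha (2 * (-P.H q / 2) - (1 * P.H q + q * deriv P.H q)) q :=
    ((P.hasDerivAt_G q).const_mul 2).sub ((hasDerivAt_id' q).mul (P.hasDerivAt_H q))
  convert h using 1
  ring

/-- `deriv α = −2H − qH′`. [folklore] -/
theorem deriv_alpha (q : ℝ) : deriv P.alpha q = -(2 * P.H q) - q * deriv P.H q :=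
  (P.hasDerivAt_alpha q).deriv

/-- **`H − 2α′ = A φ`** (the vorticity identity). [folklore] -/
theorem H_sub_two_mul_deriv_alpha (q : ℝ) : P.H q - 2 * deriv P.alpha q = P.A * P.cutoff q := by
  rw [P.deriv_alpha]
  have := P.two_mul_deriv_H q
  linarith

/-- **`2α′ + 2qH′ + 4H = 0`** (the divergence identity). [folklore] -/
theorem divergence_identity (q : ℝ) : 2 * deriv P.alpha q + 2 * q * deriv P.H q + 4 * P.H q = 0 := by
  rw [P.deriv_alpha]
  ring

/-- **The nested Hill velocity field** `v(x) = α(|x|²) e₂ + H(|x|²) x₂ x`. [folklore] -/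
def field (x : EuclideanSpace ℝ (Fin 3)) : EuclideanSpace ℝ (Fin 3) :=
  P.alpha (‖x‖ ^ 2) • EuclideanSpace.single 2 (1 : ℝ) + (P.H (‖x‖ ^ 2) * x 2) • x

/-- **The vorticity density** `η(x) = A φ(|x|²)` (`= ω_θ/r`, `angVortQuot_field`). [folklore] -/
def eta (x : EuclideanSpace ℝ (Fin 3)) : ℝ := P.A * P.cutoff (‖x‖ ^ 2)

/-- component `0`: `v₀ = H x₂ x₀`. [folklore] -/
@[simp] theorem field_apply_zero (x : EuclideanSpace ℝ (Fin 3)) : P.field x 0 = P.H (‖x‖ ^ 2) * x 2 * x 0 := by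
  simp [field]

/-- component `1`: `v₁ = H x₂ x₁`. [folklore] -/
@[simp] theorem field_apply_one (x : EuclideanSpace ℝ (Fin 3)) : P.field x 1 = P.H (‖x‖ ^ 2) * x 2 * x 1 := by
  simp [field]

/-- component `2`: `v₂ = α + H x₂²`. [folklore] -/
@[simp] theorem field_apply_two (x : EuclideanSpace ℝ (Fin 3)) :
    P.field x 2 = P.alpha (‖x‖ ^ 2) + P.H (‖x‖ ^ 2) * x 2 * x 2 := by
  simp [field]

/-- `v` is smooth. [folklore] -/
theorem contDiff_field {n : ℕ∞} : ContDiff ℝ n P.field := by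
  have hq : ContDiff ℝ n fun x : EuclideanSpace ℝ (Fin 3) => ‖x‖ ^ 2 := contDiff_norm_sq ℝ
  have h2 : ContDiff ℝ n fun x : EuclideanSpace ℝ (Fin 3) => x 2 := contDiff_apply_coord_vec3 contDiff_id 2
  show ContDiff ℝ n fun x : EuclideanSpace ℝ (Fin 3) =>
    P.alpha (‖x‖ ^ 2) • EuclideanSpace.single 2 (1 : ℝ) + (P.H (‖x‖ ^ 2) * x 2) • x
  exact ((P.alpha_contDiff.comp hq).smul contDiff_const).add
    (((P.H_contDiff.comp hq).mul h2).smul contDiff_id)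

/-- `η` is smooth. [folklore] -/
theorem contDiff_eta {n : ℕ∞} : ContDiff ℝ n P.eta :=
  contDiff_const.mul (P.cutoff_contDiff.comp (contDiff_norm_sq ℝ))

/-- `η` is continuous. [folklore] -/
theorem continuous_eta : Continuous P.eta := (P.contDiff_eta (n := 0)).continuous

/-- `0 ≤ η`. [folklore] -/
theorem eta_nonneg (x : EuclideanSpace ℝ (Fin 3)) : 0 ≤ P.eta x := mul_nonneg P.A_pos.le (P.cutoff_nonneg _)

/-- `η ≤ A`. [folklore] -/
theorem eta_le (x : EuclideanSpace ℝ (Fin 3)) : P.eta x ≤ P.A := by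
  have := mul_le_mul_of_nonneg_left (P.cutoff_le_one (‖x‖ ^ 2)) P.A_pos.le
  simpa [eta] using this

/-- `η = A` on the core ball `|x|² ≤ q₁`. [folklore] -/
theorem eta_eq_core {x : EuclideanSpace ℝ (Fin 3)} (hx : ‖x‖ ^ 2 ≤ P.q₁) : P.eta x = P.A := by
  simp [eta, P.cutoff_eq_one hx]

/-- `η = 0` off the vortical ball, `q₂ ≤ |x|²`. [folklore] -/
theorem eta_eq_zero {x : EuclideanSpace ℝ (Fin 3)} (hx : P.q₂ ≤ ‖x‖ ^ 2) : P.eta x = 0 := by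
  simp [eta, P.cutoff_eq_zero hx]

/-- The derivative of `v` at `x` (a continuous linear map). [folklore] -/
def fieldDeriv (x : EuclideanSpace ℝ (Fin 3)) : EuclideanSpace ℝ (Fin 3) →L[ℝ] EuclideanSpace ℝ (Fin 3) :=
  (deriv P.alpha (‖x‖ ^ 2) • ((2 : ℝ) • innerSL ℝ x)).smulRight (EuclideanSpace.single 2 (1 : ℝ)) +
    ((P.H (‖x‖ ^ 2) * x 2) • ContinuousLinearMap.id ℝ (EuclideanSpace ℝ (Fin 3)) +
      (P.H (‖x‖ ^ 2) • (EuclideanSpace.proj (2 : Fin 3) : EuclideanSpace ℝ (Fin 3) →L[ℝ] ℝ) +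
        x 2 • (deriv P.H (‖x‖ ^ 2) • ((2 : ℝ) • innerSL ℝ x))).smulRight x)

/-- **`Dv(x) = fieldDeriv x`.** [folklore] -/
theorem hasFDerivAt_field (x : EuclideanSpace ℝ (Fin 3)) : HasFDerivAt P.field (P.fieldDeriv x) x := by
  have hq : HasFDerivAt (fun y : EuclideanSpace ℝ (Fin 3) => ‖y‖ ^ 2) ((2 : ℝ) • innerSL ℝ x) x := by
    have h := (hasStrictFDerivAt_norm_sq (x : EuclideanSpace ℝ (Fin 3))).hasFDerivAt
    rwa [← Nat.cast_smul_eq_nsmul ℝ, Nat.cast_ofNat] at h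
  have hα := (((P.alpha_contDiff (n := 1)).differentiable (by simp)) (‖x‖ ^ 2)).hasDerivAt
    |>.comp_hasFDerivAt x hq
  have hH := (P.hasDerivAt_H (‖x‖ ^ 2)).comp_hasFDerivAt x hq
  have h2 : HasFDerivAt (fun y : EuclideanSpace ℝ (Fin 3) => y 2)
      (EuclideanSpace.proj (2 : Fin 3) : EuclideanSpace ℝ (Fin 3) →L[ℝ] ℝ) x :=
    (EuclideanSpace.proj (𝕜 := ℝ) (2 : Fin 3)).hasFDerivAt
  have hb := hH.mul h2
  exact (hα.smul_const (EuclideanSpace.single 2 (1 : ℝ))).add (hb.smul (hasFDerivAt_id x))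

/-- `v` is differentiable. [folklore] -/
theorem differentiable_field : Differentiable ℝ P.field := fun x => (P.hasFDerivAt_field x).differentiableAt

/-- **The derivative in components**: `∂ⱼ vᵢ = Dv(x) eⱼ · eᵢ`. [folklore] -/
theorem fderiv_field_single (x : EuclideanSpace ℝ (Fin 3)) (j i : Fin 3) :
    fderiv ℝ P.field x (EuclideanSpace.single j 1) i =
      2 * deriv P.alpha (‖x‖ ^ 2) * x j * (EuclideanSpace.single 2 (1 : ℝ) : EuclideanSpace ℝ (Fin 3)) i +
        P.H (‖x‖ ^ 2) * x 2 * (EuclideanSpace.single j (1 : ℝ) : EuclideanSpace ℝ (Fin 3)) i +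
        (P.H (‖x‖ ^ 2) * (EuclideanSpace.single j (1 : ℝ) : EuclideanSpace ℝ (Fin 3)) 2 +
          2 * x 2 * deriv P.H (‖x‖ ^ 2) * x j) * x i := by
  rw [(P.hasFDerivAt_field x).fderiv]
  have hp :
      (EuclideanSpace.proj (2 : Fin 3) : EuclideanSpace ℝ (Fin 3) →L[ℝ] ℝ) (EuclideanSpace.single j (1 : ℝ)) =
      (EuclideanSpace.single j (1 : ℝ) : EuclideanSpace ℝ (Fin 3)) 2 := rfl
  simp [fieldDeriv, EuclideanSpace.inner_single_right, hp]
  ring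

/-- **`curl v = η J`**: the vorticity is `η(x) (−x₁, x₀, 0)`. [folklore] -/
theorem curl_field (x : EuclideanSpace ℝ (Fin 3)) : curl P.field x = P.eta x • rotGen x := by
  have hid := P.H_sub_two_mul_deriv_alpha (‖x‖ ^ 2)
  ext i
  fin_cases i
  · simp [curl, P.fderiv_field_single, eta]
    linear_combination (-(x 1 : ℝ)) * hid
  · simp [curl, P.fderiv_field_single, eta]
    linear_combination (x 0 : ℝ) * hid
  · simp [curl, P.fderiv_field_single, eta]
    ring

/-- **`div v = 0`.** [folklore] -/
theorem isDivFree_field : VectorCalculus.IsDivFree P.field := by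
  intro x
  have hn : ‖x‖ ^ 2 = x 0 ^ 2 + x 1 ^ 2 + x 2 ^ 2 := by
    rw [EuclideanSpace.real_norm_sq_eq, Fin.sum_univ_three]
  have hid := P.divergence_identity (‖x‖ ^ 2)
  rw [hn] at hid
  rw [divergence_eq_sum_three]
  simp [P.fderiv_field_single, hn]
  linear_combination (x 2 : ℝ) * hid

end Field

end HillData

end Summit.NavierStokesRegularity.HeredityAtOneNestedHill

end
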